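import Summits.ResolutionOfSingularities.ResolutionOfSingularities.Theorems.FrobeniusClosingPatchingRelPerfectDepthLegalStepAPieces
import Summits.ResolutionOfSingularities.ResolutionOfSingularities.Theorems.FrobeniusClosingPatchingRelPerfectDepthWeightTwoBCJS
import Literature.AlgebraicGeometry.Resolution.EmbeddedResolutionExcellentSurfacesSequence
import Literature.AlgebraicGeometry.Resolution.StrictTransformClosedSetPieces
import Literature.AlgebraicGeometry.Resolution.ExcellentClosedSubschemes
import Literature.AlgebraicGeometry.Resolution.RegularLocalRingsQuotient
import Literature.AlgebraicGeometry.Resolution.SubschemeRegularStalks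
import Literature.AlgebraicGeometry.Resolution.RegularCentreComponents
import Literature.AlgebraicGeometry.Resolution.NonPrincipalLocus
import Literature.Topology.KrullDimensionDrop
import HarnessLib

/-!
# Crux `PatchingRelPerfect` (stmt-ResolutionOfSingularities-16161), chain W5.2 — T6-E1b residual `LegalScopedDivisorReduction₃`,
# PHASE 2 closer (2b), brick B4/A4: STEP A — COSSART–JANNSEN–SAITO ON THE TRACE CURVE OF THE HOST, LIFTED BY POINT MOVES

[OURS · L1 W5.2 · res-L1-w52-stub-1 g4 for B4 «STEP A» (plan-1 NAMING N7; lead-1 `PHASE2-SEPARATION-GAME.md` v2)] Replaces the role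
of NO printed item; NOT a statement of the manuscript under review.  The named fact `CossartJannsenSaito2020EmbeddedSequenceB` (F-32bR)
is consumed ONLY in the final packaging `HostState.stepA`, as a hypothesis, with `dim X ≤ 2` (in fact a curve: the trace `Supp T` of
the boundary monomial on the regular host surface `V(D)`).

THE TRANSPORT (`HostState.stepA_transport`).  Along a `𝓑`-permissible sequence `σ : Z′ → V(D₁)` over the trace `Supp T₁`
(`IsBPermissibleSequenceB (Supp T₁) ∅ σ XC′ B′`) we carry, ISO-TOLERANTLY: the ambient state one floor up (`E′` integral Noetherian
excellent of dimension `≤ 3`, the running `IsPureWeightedSeq 2`, `HostState H′ D′ L′`, the curve clause), an isomorphism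
`e : V(D′) ≅ Z′`, and the bookkeeping ⟨UPPER `e(Supp T′) ⊆ XC′ ∪ B′`, LOWER `e⁻¹ XC′ ⊆ Supp T′`, (NB) `XC′ ⊆ cl(XC′ ∖ B′)`⟩.  A step with
EMPTY centre is an isomorphism (absorbed into `e`); every point of a NON-empty centre is a CLOSED point of `XC′` (A3
`isClosed_singleton_of_mem_centre`), the pieces are single points and the points loop (A3 `points_loop`, A2 `point_step`) lifts them;
the three bookkeeping clauses are re-established with `IsBlowup.preimage_closure_diff_support_subset` (closures commute with the
blow-up off its centre).

THE END (`HostState.stepA`).  Apply F-32bR (`.of_isClosed`) on the regular excellent surface `V(D)` to the closed curve `Supp T`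
(dimension `≤ 2`: it embeds in the proper closed subset `Supp D` of the irreducible threefold) and transport; the output is the state
one floor up TOGETHER WITH the CJS end data on a surface `Z₁ ≅ V(D′)` — `cl X₁` regular, `B₁` a strict normal crossings divisor,
`X₁ ⋔ B₁` — and `e(Supp T′) ⊆ X₁ ∪ B₁ ⊇`, `e⁻¹ X₁ ⊆ Supp T′`.  (Consumers transport the end clauses they need through `e`; a member
whose trace on the host crosses itself stays tangent to the host at the crossing — point moves cannot remove that, see the STATUS
note of 2026-08-27 13:47:58Z.)

AI-written; AI review is weaker than expert review.

## References
* V. Cossart, U. Jannsen, S. Saito, LNM 2270 (2020), Thm. 1.4, (6.2), Def. 6.8, Thm. 6.9 (a). [CossartJannsenSaito2020]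
* E. Bierstone, D. Grigoriev, P. Milman, J. Włodarczyk, arXiv:1206.3090, §4 Step 2b, Remark (3). [BierstoneGrigorievMilmanWlodarczyk2011]
* The Stacks Project, Tags 02OS, 080A, 01J7. [StacksProject]
-/

-- `Summit.<Summit>.<Sub>.Theorems` with `Sub = Summit` (single-conjunct summit, D-0017)
set_option linter.dupNamespace false

noncomputable section

open CategoryTheory CategoryTheory.Limits AlgebraicGeometry TopologicalSpace IsLocalRing
open Literature.AlgebraicGeometry.Resolution Scheme.IdealSheafData

namespace Summit.ResolutionOfSingularities.ResolutionOfSingularities.Theorems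

universe u

namespace DepthLegal

open WeightTwoB DepthTargets

namespace HostState

/-! ## §11 The transport along a Cossart–Jannsen–Saito sequence over the trace curve -/

/-- [OURS · L1 W5.2] **STEP A TRANSPORT** (module docstring): along a `𝓑`-permissible sequence over the trace curve of the host, the
state of the separation game is carried one floor up, point move by point move, with an isomorphism between the current host and the
current CJS surface and the bookkeeping ⟨UPPER, LOWER, (NB)⟩.
[cite: CossartJannsenSaito2020, Thm. 1.4, (6.2), Thm. 6.9 (a)] [cite: BierstoneGrigorievMilmanWlodarczyk2011, §4 Step 2b] -/
theorem stepA_transport {E₀ E₁ : Scheme.{u}} [IsIntegral E₁] [IsNoetherian E₁] {ρ₁ : E₁ ⟶ E₀} {H₀ : E₀.IdealSheafData}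
    {H₁ D₁ : E₁.IdealSheafData} {L₁ : List (E₁.IdealSheafData × ℕ)} (S₁ : HostState H₁ D₁ L₁)
    (hseq₁ : IsPureWeightedSeq 2 ρ₁ H₀ H₁) (hexc₁ : Scheme.IsExcellent E₁) (hdim₁ : topologicalKrullDim E₁ ≤ 3)
    (hcurve₁ : ∀ x ∈ D₁.support, x ∈ (monomialIdeal L₁).support → 1 < Order.coheight x) :
    ∀ {Z' : Scheme.{u}} {σ : Z' ⟶ D₁.subscheme} {XC B' : Set Z'},
      IsBPermissibleSequenceB ((((monomialIdeal L₁).comap D₁.subschemeι).support : Set D₁.subscheme)) (∅ : Set _) σ XC B' →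
      IsClosed XC ∧ IsClosed B' ∧
        ∃ (E' : Scheme.{u}) (_ : IsIntegral E') (_ : IsNoetherian E') (_ : IsNoetherian Z') (ρ' : E' ⟶ E₀)
          (H' D' : E'.IdealSheafData) (L' : List (E'.IdealSheafData × ℕ)) (_ : HostState H' D' L')
          (e : D'.subscheme ≅ Z'),
          IsPureWeightedSeq 2 ρ' H₀ H' ∧ Scheme.IsExcellent E' ∧ topologicalKrullDim E' ≤ 3 ∧
          (∀ x ∈ D'.support, x ∈ (monomialIdeal L').support → 1 < Order.coheight x) ∧
          (∀ x : D'.subscheme, x ∈ (((monomialIdeal L').comap D'.subschemeι).support : Set D'.subscheme) →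
              e.hom x ∈ XC ∪ B') ∧
          (∀ z : Z', z ∈ XC → e.inv z ∈ (((monomialIdeal L').comap D'.subschemeι).support : Set D'.subscheme)) ∧
          XC ⊆ closure (XC \ B') := by
  intro Z' σ XC B' h
  induction h with
  | refl =>
    refine ⟨((monomialIdeal L₁).comap D₁.subschemeι).support.isClosed, isClosed_empty, E₁, inferInstance, inferInstance, ?_,
      ρ₁, H₁, D₁, L₁, S₁, Iso.refl _, hseq₁, hexc₁, hdim₁, hcurve₁, ?_, ?_, ?_⟩
    · -- `V(D₁)` is Noetherian (closed subscheme of a Noetherian scheme)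
      exact isNoetherian_subscheme D₁
    · intro x hx
      exact Or.inl (by simpa using hx)
    · intro z hz
      simpa using hz
    · rw [Set.sdiff_empty]
      exact subset_closure
  | @blowup Z' Z'' σ XC B' _ C τ hτ hreg hsub hBsing hperm hnc ih =>
    obtain ⟨hXCc, hB'c, E', hint, hnoeth, hnoethZ, ρ', H', D', L', S', e, hseq, hexc, hdim, hcurve, hU, hL, hNB⟩ := ih
    haveI := hint
    haveI := hnoeth
    haveI := hnoethZ
    haveI : IsNoetherian Z'' := isNoetherian_of_isBlowup hτ
    refine ⟨isClosed_closure, ?_, ?_⟩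
    · -- the new boundary `τ⁻¹(B' ∪ V(C))` is closed
      exact (hB'c.union C.support.isClosed).preimage τ.continuous
    by_cases hC0 : C = ⊤
    · /- EMPTY centre: `τ` is an isomorphism, absorbed into `e` -/
      haveI := isIso_of_isBlowup_top hτ hC0
      have hCs : (C.support : Set Z') = ∅ := by
        rw [hC0, Scheme.IdealSheafData.support_top]; rfl
      have hXC'' : closure (τ ⁻¹' (XC \ (C.support : Set Z'))) = τ ⁻¹' XC := by
        rw [hCs, Set.sdiff_empty, (hXCc.preimage τ.continuous).closure_eq]
      refine ⟨E', hint, hnoeth, inferInstance, ρ', H', D', L', S', e ≪≫ (asIso τ).symm, hseq, hexc, hdim, hcurve,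
        fun x hx => ?_, fun z hz => ?_, ?_⟩
      · -- UPPER
        rw [hXC'', hCs, Set.union_empty]
        have h := hU x hx
        have hτe : τ ((e ≪≫ (asIso τ).symm).hom x) = e.hom x := by
          simp only [Iso.trans_hom, Iso.symm_hom, asIso_inv, Scheme.Hom.comp_apply]
          rw [← Scheme.Hom.comp_apply, IsIso.inv_hom_id]; rfl
        rcases h with h | h
        · exact Or.inl (show τ _ ∈ XC by rw [hτe]; exact h)
        · exact Or.inr (show τ _ ∈ B' by rw [hτe]; exact h)
      · -- LOWER
        rw [hXC''] at hz
        have h := hL (τ z) hz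
        simpa only [Iso.trans_inv, Iso.symm_inv, asIso_hom, Scheme.Hom.comp_apply] using h
      · -- (NB)
        rw [hXC'', hCs, Set.union_empty]
        have hopen : IsOpenMap τ := τ.isOpenEmbedding.isOpenMap
        calc (τ ⁻¹' XC : Set Z'') ⊆ τ ⁻¹' closure (XC \ B') := Set.preimage_mono hNB
          _ ⊆ closure (τ ⁻¹' (XC \ B')) := hopen.preimage_closure_subset_closure_preimage
          _ = closure (τ ⁻¹' XC \ τ ⁻¹' B') := by rw [Set.preimage_sdiff]
    · /- NON-EMPTY centre: every point of `V(C)` is a closed point of `XC`; re-sequence point by point -/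
      -- no specialisation chain of length two in `XC`
      have hchain : ∀ a b c : Z', a ∈ XC → a ⤳ b → b ⤳ c → a = b ∨ b = c := fun a b c ha hab hbc =>
        eq_or_eq_of_specializes_of_lower hdim hcurve e hL ha hab hbc
      have hpts : ∀ ξ ∈ (C.support : Set Z'), IsClosed ({ξ} : Set Z') ∧ ξ ∈ XC := fun ξ hξ =>
        isClosed_singleton_of_mem_centre hXCc hB'c hNB hchain hsub hBsing hξ
      -- the pieces of the centre: single closed points over the trace
      have hP : IsPiecePartition C (Kollar2007.boundaryPieces C) := isPiecePartition_boundaryPieces_of_isRegular hreg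
      have hne : Kollar2007.boundaryPieces C ≠ [] := fun h0 => hC0 (boundaryPieces_eq_nil_iff.mp h0)
      have hpt : ∀ W ∈ Kollar2007.boundaryPieces C, ∃ ξ : Z', (W : Set Z') = {ξ} ∧
          e.inv ξ ∈ (((monomialIdeal L').comap D'.subschemeι).support : Set D'.subscheme) := by
        intro W hW
        have hWC : (W : Set Z') ⊆ C.support := hP.subset hW
        obtain ⟨ξ, hWξ⟩ := exists_eq_singleton_of_forall_isClosed (isIrreducible_of_mem_boundaryPieces hW) W.isClosed
          (fun x hx => (hpts x (hWC hx)).1)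
        have hξW : ξ ∈ (W : Set Z') := by rw [hWξ]; rfl
        exact ⟨ξ, hWξ, hL ξ (hpts ξ (hWC hξW)).2⟩
      -- the points loop
      obtain ⟨E'', hint'', hnoeth'', ρ'', H'', D'', L'', S'', e'', hseq'', hexc'', hdim'', hcurve'', hU'', hL''⟩ :=
        S'.points_loop hseq hexc hdim hcurve e hreg hne hP hpt hτ
      refine ⟨E'', hint'', hnoeth'', inferInstance, ρ'', H'', D'', L'', S'', e'', hseq'', hexc'', hdim'', hcurve'',
        fun x hx => ?_, ?_, ?_⟩
      · -- UPPER: `τ (e'' x)` lies over `Supp T′`, hence in `XC ∪ B'`; off `B' ∪ V(C)` it is a point of `τ⁻¹(XC ∖ V(C))`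
        have h2 := hU _ (hU'' x hx)
        rw [hom_inv_apply] at h2
        by_cases hB : τ (e''.hom x) ∈ B' ∪ (C.support : Set Z')
        · exact Or.inr hB
        · exact Or.inl (subset_closure ⟨h2.resolve_right fun h => hB (Or.inl h), fun h => hB (Or.inr h)⟩)
      · -- LOWER: the points `z` with `e''⁻¹ z ∈ Supp T″` form a closed set containing `τ⁻¹(XC ∖ V(C))`
        have hYc : IsClosed {z : Z'' | e''.inv z ∈ (((monomialIdeal L'').comap D''.subschemeι).support : Set D''.subscheme)} :=
          ((monomialIdeal L'').comap D''.subschemeι).support.isClosed.preimage e''.inv.continuous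
        have hsubY : τ ⁻¹' (XC \ (C.support : Set Z')) ⊆
            {z : Z'' | e''.inv z ∈ (((monomialIdeal L'').comap D''.subschemeι).support : Set D''.subscheme)} := by
          intro z hz
          have hz' : τ (e''.hom (e''.inv z)) ∉ (C.support : Set Z') := by rw [hom_inv_apply]; exact hz.2
          have hzT : e.inv (τ (e''.hom (e''.inv z))) ∈ (((monomialIdeal L').comap D'.subschemeι).support : Set D'.subscheme) := by
            rw [hom_inv_apply]; exact hL _ hz.1
          exact hL'' (e''.inv z) hz' hzT
        intro z hz
        exact hYc.closure_subset_iff.mpr hsubY hz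
      · -- (NB): it suffices to put `τ⁻¹(XC ∖ V(C))` inside the closure of `XC″ ∖ B″`
        refine closure_minimal (fun x'' hx'' => ?_) isClosed_closure
        have hx : τ x'' ∈ XC \ (C.support : Set Z') := hx''
        -- `τ x'' ∈ cl((XC ∖ B') ∖ V(C))`
        have hA : τ x'' ∈ closure ((XC \ B') \ (C.support : Set Z')) := by
          have h1 : τ x'' ∈ closure (XC \ B') := hNB hx.1
          have h2 : XC \ B' ⊆ ((XC \ B') \ (C.support : Set Z')) ∪ (C.support : Set Z') := by
            intro z hz
            by_cases hzC : z ∈ (C.support : Set Z')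
            · exact Or.inr hzC
            · exact Or.inl ⟨hz, hzC⟩
          have h3 := closure_mono h2 h1
          rw [closure_union, C.support.isClosed.closure_eq] at h3
          exact h3.resolve_right hx.2
        -- pulled back along `τ`, an isomorphism off `V(C)`
        have hB := hτ.preimage_closure_diff_support_subset ((XC \ B') \ (C.support : Set Z')) ⟨hA, hx.2⟩
        refine closure_mono (fun z hz => ?_) hB
        refine ⟨subset_closure ⟨hz.1.1, hz.2⟩, ?_⟩
        rintro (h | h)
        · exact hz.1.2 h
        · exact hz.2 h

/-! ## §12 STEP A: the end -/

section End

variable {E : Scheme.{u}} [IsIntegral E] [IsNoetherian E] {E₀ : Scheme.{u}} {ρ : E ⟶ E₀} {H₀ : E₀.IdealSheafData}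
  {H D : E.IdealSheafData} {L : List (E.IdealSheafData × ℕ)} (S : HostState H D L)

omit [IsIntegral E] in
include S in
/-- The host `V(D)` of a `HostState` is a regular scheme (order-one stalk generators on a regular ambient scheme, Matsumura 14.2).
[folklore] -/
theorem isRegular_host : Scheme.IsRegular D.subscheme := by
  refine Scheme.isRegular_subscheme_of_forall D fun x hx => ?_
  haveI := S.regE x
  obtain ⟨v, hv, hv2⟩ := S.hostHyp x hx
  have hvm : v ∈ maximalIdeal (E.presheaf.stalk x) :=
    (mem_support_iff_stalkIdeal_le D x).mp hx (hv ▸ Ideal.mem_span_singleton_self v)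
  rw [hv]
  exact (IsRegularLocalRing.quotient_span_singleton hvm hv2).1

include S in
/-- The host is a PROPER closed subset of the integral ambient scheme. [folklore] -/
theorem support_host_ne_univ : (D.support : Set E) ≠ Set.univ := by
  intro h
  have hη : genericPoint E ∈ D.support := by
    change genericPoint E ∈ (D.support : Set E)
    rw [h]; exact Set.mem_univ _
  exact not_mem_support_genericPoint (S.host_ne_bot hη) hη

include S in
/-- The trace `Supp T ⊆ V(D)` has dimension `≤ 2` when `dim E ≤ 3` (it embeds in the proper closed subset `Supp D` of the irreducible
`E`). [folklore] -/
theorem topologicalKrullDim_trace_le_two (hdim : topologicalKrullDim E ≤ 3) :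
    topologicalKrullDim (((monomialIdeal L).comap D.subschemeι).support : Set D.subscheme) ≤ 2 := by
  -- `dim Supp D ≤ 2`
  have hD : topologicalKrullDim (D.support : Set E) ≤ 2 := by
    have hlt := Literature.Topology.topologicalKrullDim_lt_of_isClosed_ssubset D.support.isClosed S.support_host_ne_univ (2 + 1)
      (lt_of_le_of_lt hdim (by exact_mod_cast (by norm_num : (3 : ℕ) < 2 + 1 + 1)))
    rw [Nat.cast_add_one] at hlt
    exact_mod_cast (ENat.WithBot.lt_add_one_iff.mp hlt)
  -- the trace embeds into `Supp D`
  have hmem : ∀ x : (((monomialIdeal L).comap D.subschemeι).support : Set D.subscheme),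
      D.subschemeι x.1 ∈ (D.support : Set E) := fun x => subschemeι_apply_mem_support D x.1
  have hgi : Topology.IsInducing (Set.codRestrict (fun x : (((monomialIdeal L).comap D.subschemeι).support : Set D.subscheme) =>
      D.subschemeι x.1) (D.support : Set E) hmem) :=
    (D.subschemeι.isClosedEmbedding.isInducing.comp Topology.IsInducing.subtypeVal).codRestrict hmem
  exact hgi.topologicalKrullDim_le.trans hD

include S in
/-- [OURS · L1 W5.2] **STEP A** (module docstring): Cossart–Jannsen–Saito, run on the regular excellent host surface `V(D)` over the
trace curve `Supp T` of the boundary monomial (F-32bR, a hypothesis), lifted to the threefold by point moves: the state of the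
separation game one floor up, an identification `e : V(D′) ≅ Z₁` with the final CJS surface, the CJS end clauses on `Z₁`
(`cl X₁` regular, `B₁` a strict normal crossings divisor, `X₁` transversal to `B₁`), and the trace bookkeeping `e(Supp T′) ⊆ X₁ ∪ B₁`,
`e⁻¹ X₁ ⊆ Supp T′`. [cite: CossartJannsenSaito2020, Thm. 1.4, (6.2), Thm. 6.9 (a)] [cite: BierstoneGrigorievMilmanWlodarczyk2011, §4 Step 2b, Remark (3)] -/
theorem stepA (hCJS : CossartJannsenSaito2020EmbeddedSequenceB.{u}) (hseq : IsPureWeightedSeq 2 ρ H₀ H)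
    (hexc : Scheme.IsExcellent E) (hdim : topologicalKrullDim E ≤ 3)
    (hcurve : ∀ x ∈ D.support, x ∈ (monomialIdeal L).support → 1 < Order.coheight x) :
    ∃ (E' : Scheme.{u}) (_ : IsIntegral E') (_ : IsNoetherian E') (ρ' : E' ⟶ E₀) (H' D' : E'.IdealSheafData)
      (L' : List (E'.IdealSheafData × ℕ)) (_ : HostState H' D' L'),
      IsPureWeightedSeq 2 ρ' H₀ H' ∧ Scheme.IsExcellent E' ∧ topologicalKrullDim E' ≤ 3 ∧
      (∀ x ∈ D'.support, x ∈ (monomialIdeal L').support → 1 < Order.coheight x) ∧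
      ∃ (Z₁ : Scheme.{u}) (_ : IsNoetherian Z₁) (e : D'.subscheme ≅ Z₁) (X₁ B₁ : Set Z₁),
        IsClosed X₁ ∧ IsClosed B₁ ∧ Scheme.IsRegular Z₁ ∧
        Scheme.IsRegular (vanishingIdeal ⟨closure X₁, isClosed_closure⟩).subscheme ∧
        IsStrictNormalCrossingsDivisor Z₁ B₁ ∧ IsTransversalWith Z₁ X₁ B₁ ∧
        (∀ x : D'.subscheme, x ∈ (((monomialIdeal L').comap D'.subschemeι).support : Set D'.subscheme) → e.hom x ∈ X₁ ∪ B₁) ∧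
        (∀ z : Z₁, z ∈ X₁ → e.inv z ∈ (((monomialIdeal L').comap D'.subschemeι).support : Set D'.subscheme)) := by
  haveI : IsNoetherian D.subscheme := isNoetherian_subscheme D
  -- CJS on the host over the trace curve
  obtain ⟨Z₁, π, X₁, B₁, hT, hZ₁, -, -, -, hX₁, hB₁, -, htr⟩ :=
    hCJS.of_isClosed D.subscheme S.isRegular_host (Scheme.IsExcellent.of_isClosedImmersion D.subschemeι hexc)
      ((((monomialIdeal L).comap D.subschemeι).support : Set D.subscheme)) ((monomialIdeal L).comap D.subschemeι).support.isClosed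
      (S.topologicalKrullDim_trace_le_two hdim)
  -- transport
  obtain ⟨hX₁c, hB₁c, E', hint, hnoeth, hnoethZ, ρ', H', D', L', S', e, hseq', hexc', hdim', hcurve', hU, hL, -⟩ :=
    S.stepA_transport hseq hexc hdim hcurve hT
  exact ⟨E', hint, hnoeth, ρ', H', D', L', S', hseq', hexc', hdim', hcurve', Z₁, hnoethZ, e, X₁, B₁, hX₁c, hB₁c, hZ₁, hX₁, hB₁,
    htr, hU, hL⟩

end End

end HostState

end DepthLegal

end Summit.ResolutionOfSingularities.ResolutionOfSingularities.Theorems
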